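import Literature.Probability.Moments.StochasticTraceEstimator
import HarnessLib

/-!
# Dilution of stochastic noise: the diluted trace and matrix-element estimators are unbiased,
# their variance is the undiluted variance with the cross-block terms struck out, and full
# dilution is exact

Topic `Probability/Moments`; sequel of `StochasticTraceEstimator.lean` (the single-probe
estimators `zᵀAz` of `tr A` and `Xᵢηⱼ` of `Bᵢⱼ` for i.i.d. components of a real UNIT NOISE `μ`,
their unbiasedness and exact variances — Hutchinson / Avron–Toledo / Dong–Liu).  PUBLISHED RESULTS
with our formalisation of the printed statements; no named fact (`def … : Prop`) is introduced.

## Sources (read on the materialised texts) and what is taken from each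

* J. Foley, K. J. Juge, A. Ó Cais, M. Peardon, S. M. Ryan, J.-I. Skullerud, *Practical all-to-all
  propagators for lattice QCD*, Comput. Phys. Commun. 172 (2005) 145–162 [FoleyEtAl2005]
  (held text `paper:arxiv-hep-lat_0505023`, chunks p0004–p0005), §2.1 "Noisy estimators and
  dilution": noise vectors with `⟨η(x) ⊗ η(y)†⟩ = δ_{x,y}` and components of modulus one
  ("`η(x)^* η(x) = 1` (no summation)", their eq. (mod1)); "We propose to remove the O(1) random
  noise by 'diluting' the noise vector in some set of variables `(j)` such that `η = Σ_j η^{(j)}` …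
  'time dilution' where the noise vector is broken up into pieces which only have support on a
  single timeslice each, `η(x,t) = Σ_{j} η^{(j)}(x,t)`, where `η^{(j)}(x,t) = 0` unless `t = j`.
  Each diluted source is inverted, yielding `N_d` pairs of vectors `{ψ^{(j)}, η^{(j)}}`, which then
  gives an unbiased estimator of `M⁻¹` with a *single* noise source, `Σ_i ψ^{(i)} ⊗ η^{(i)†}`" and
  "The 'homeopathic' limit of the dilution procedure, where we have one noise vector for each time,
  space, colour and spin component, results in the *exact* all-to-all propagator in a finite number
  of steps, because of the property of Eq. (mod1)"; §2.2: "the noise vectors are mutually orthogonal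
  due to the dilution … This results in smaller variance than the standard method which mixes noise".
* C. Morningstar, J. Bulava, J. Foley, K. J. Juge, D. Lenkner, M. Peardon, C. H. Wong, *Improved
  stochastic estimation of quark propagation with Laplacian Heaviside smearing in lattice QCD*,
  Phys. Rev. D 83 (2011) 114505 [MorningstarEtAl2011] (held text `paper:arxiv-1104.3870`, chunks
  p0007–p0008), §III: "`E(Xᵢ ηⱼ^*) = Ω⁻¹ᵢⱼ` … A given dilution scheme can be viewed as the
  application of a complete set of projection operators `P^{(b)}`. Define `η^{r[b]} = P^{(b)} η^r`,
  and define `X^{r[b]}` as the solution of `Ω X^{r[b]} = η^{r[b]}`, then a much better Monte Carlo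
  estimate of `Ω⁻¹ᵢⱼ` is `Ω⁻¹ᵢⱼ ≈ N_R⁻¹ Σ_r Σ_b X^{r[b]}_i η^{r[b]*}_j`. The dilution projections
  ensure exact zeros for many of the `E(ηᵢηⱼ^*)` elements instead of estimates that are only
  statistically zero, resulting in a dramatic reduction in the variance of the `Ω⁻¹` estimates. The
  use of `Z_N` noise ensures zero variance in our estimates of the diagonal elements `E(ηᵢηᵢ^*)`.
  The effectiveness of the variance reduction depends on the projectors chosen" and the four schemes
  "`P^{(b)}_{ij} = δ_{ij}` (no dilution); `δ_{ij} δ_{bi}` (full dilution); `δ_{ij} δ_{b,⌊Ji/N⌋}`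
  (block-J); `δ_{ij} δ_{b, i mod J}` (interlace-J) … each projector is a diagonal matrix with some or
  all of the diagonal elements set to unity".
* The variance FORMULAS below are not displayed in either source; they are the tree's Dong–Liu /
  Hutchinson formulas (`StochasticTrace.variance_traceEst`, `StochasticTrace.variance_elemEst`
  [DongLiu1994, eq. (5)]) applied to the masked matrices, which is how "exact zeros for many of the
  `E(ηᵢηⱼ^*)` elements" acts on the variance.

## Lean reading (real noise, as in the parent file)

A DILUTION SCHEME is a colouring `c : n → κ` of the index set by a finite type of block labels
(the complete family of diagonal projectors `P^{(b)} = diag(𝟙[c i = b])`, `b : κ`; time dilution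
is `c = Prod.fst` on `n = T × S`, full dilution is an injective `c`, no dilution a constant `c`).
`dilute c b z` is `P^{(b)} z`.  The DILUTED TRACE ESTIMATOR is `Σ_b (P^{(b)}z)ᵀ A (P^{(b)}z)` and
the DILUTED MATRIX-ELEMENT ESTIMATOR of `Bᵢⱼ` (`B = Ω⁻¹`, `X^{[b]} = B η^{[b]}`) is
`Σ_b X^{[b]}_i η^{[b]}_j` — ONE noise vector, `card κ` solves.

## What is proved (all for i.i.d. components of any unit noise `μ`; `m₄ = ∫ x⁴ dμ`)

* `sum_dilute` (`Σ_b η^{[b]} = η`), `dotProduct_dilute_of_ne` (distinct blocks are orthogonal);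
* `dilutedTraceEst_eq` — the diluted trace estimator IS the undiluted estimator of the block-masked
  matrix `blockMask c A` (`A_ij 𝟙[c i = c j]`), which has the same trace and diagonal; hence
  **`integral_dilutedTraceEst`** (unbiased: `E = tr A`) and **`variance_dilutedTraceEst`**:
  `Var = (m₄ − 1) Σᵢ A²ᵢᵢ + Σ_{i ≠ j, c i = c j} Aᵢⱼ(Aᵢⱼ + Aⱼᵢ)` — the undiluted variance with every
  cross-block pair struck out;
* **`variance_dilutedTraceEst_mono`** — refining the scheme never increases the variance (each
  unordered pair contributes `(Aᵢⱼ + Aⱼᵢ)² ≥ 0`), in particular **`variance_dilutedTraceEst_le`**: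
  every dilution scheme has variance `≤` the undiluted one ("smaller variance than the standard
  method which mixes noise");
* full dilution (`c` injective): `dilutedTraceEst_of_injective` (`= Σᵢ Aᵢᵢ zᵢ²`),
  `variance_dilutedTraceEst_of_injective` (`= (m₄ − 1) Σᵢ A²ᵢᵢ`), `…_rademacher` (`= 0`) and the
  pointwise **`dilutedTraceEst_eq_trace_of_injective`**: with unit-modulus components the fully
  diluted estimate IS `tr A` for EVERY noise draw ("exact … because of the property (mod1)");
* the same four statements for the matrix-element estimator: `dilutedElemEst_eq`,
  **`integral_dilutedElemEst`** (`E = Bᵢⱼ`, "an unbiased estimator of `M⁻¹` with a single noise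
  source"), **`variance_dilutedElemEst`** (`(m₄ − 1)B²ᵢⱼ + Σ_{k ≠ j, c k = c j} B²ᵢₖ`),
  `variance_dilutedElemEst_mono/_le`, and full dilution `variance_dilutedElemEst_of_injective`
  (`(m₄ − 1) B²ᵢⱼ`, zero for `±1` noise) / **`dilutedElemEst_eq_of_injective`** (exact pointwise);
* `card_blocks_le` / `card_blocks_eq_iff` — the number of solves per noise vector (= number of
  non-empty blocks) is at most `card n`, with equality iff the scheme is full dilution ("the exact
  all-to-all propagator in a finite number of steps").

Scope.  Real noise and real matrices, as in the parent file (complex `Z_N`/`U(1)` noise: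
TODO(general form)); one noise vector (averages over `N_r` vectors divide every variance by `N_r`,
not restated); the interplay with low-mode deflation (the "hybrid" method of [FoleyEtAl2005] §2.2)
is `DeflatedTraceEstimator.lean`'s subject, not this file's.

Context (cell pub-lqcd, HOME/R2-SCOPE.md §3 N2 / X-5b, D3, E7): the cost of a stochastic
`Tr`/`M⁻¹` estimate is (solves per noise) × (noises); dilution trades the second factor for the
first at a variance given exactly by the formulas below.
-/

namespace Literature.Probability.Moments

open _root_.MeasureTheory _root_.ProbabilityTheory Finset

namespace StochasticTrace

namespace Dilution

variable {n : Type*} [Fintype n] [DecidableEq n] {κ : Type*} [Fintype κ] [DecidableEq κ]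

/-! ## Diluted noise vectors -/

/-- The DILUTED noise vector `η^{[b]} = P^{(b)} η`: the components of `z` in block `b` of the
scheme `c`, zero elsewhere ("`η^{(j)}(x,t) = 0` unless `t = j`"). [cite: FoleyEtAl2005, §2.1
(time dilution display)]; [cite: MorningstarEtAl2011, §III (`η^{r[b]} = P^{(b)} η^r`)] -/
def dilute (c : n → κ) (b : κ) (z : n → ℝ) : n → ℝ := fun i => if c i = b then z i else 0

omit [Fintype n] [DecidableEq n] [Fintype κ] in
/-- Unfolding `dilute`. [cite: MorningstarEtAl2011, §III (`P^{(b)}` diagonal with entries `0/1`)] -/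
@[simp] theorem dilute_apply (c : n → κ) (b : κ) (z : n → ℝ) (i : n) :
    dilute c b z i = if c i = b then z i else 0 := rfl

omit [Fintype n] [DecidableEq n] in
/-- **Completeness of a dilution scheme**: `Σ_b η^{[b]} = η` ("diluting the noise vector in some
set of variables `(j)` such that `η = Σ_j η^{(j)}`"; Morningstar et al.: "a complete set of
projection operators"). [cite: FoleyEtAl2005, §2.1 (`η = Σ_j η^{(j)}`)];
[cite: MorningstarEtAl2011, §III] -/
theorem sum_dilute (c : n → κ) (z : n → ℝ) : ∑ b, dilute c b z = z := by
  ext i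
  simp [Finset.sum_apply]

omit [Fintype n] [DecidableEq n] [Fintype κ] in
/-- Products of diluted components: `η^{[b]}_i η^{[b']}_j = 𝟙[c i = b ∧ c j = b'] ηᵢ ηⱼ`.
[cite: MorningstarEtAl2011, §III ("exact zeros for many of the `E(ηᵢηⱼ^*)` elements")] -/
theorem dilute_mul_dilute (c : n → κ) (b b' : κ) (z : n → ℝ) (i j : n) :
    dilute c b z i * dilute c b' z j = if c i = b ∧ c j = b' then z i * z j else 0 := by
  by_cases h1 : c i = b <;> by_cases h2 : c j = b' <;> simp [h1, h2]

omit [Fintype n] [DecidableEq n] [Fintype κ] in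
/-- **Distinct blocks have disjoint supports**: `η^{[b]}_i η^{[b']}_i = 0` for `b ≠ b'`.
[cite: FoleyEtAl2005, §2.2 ("the noise vectors are mutually orthogonal due to the dilution")] -/
theorem dilute_mul_dilute_of_ne (c : n → κ) {b b' : κ} (h : b ≠ b') (z : n → ℝ) (i : n) :
    dilute c b z i * dilute c b' z i = 0 := by
  rw [dilute_mul_dilute, if_neg]
  rintro ⟨h1, h2⟩
  exact h (h1.symm.trans h2)

omit [DecidableEq n] [Fintype κ] in
/-- **Distinct diluted vectors are orthogonal**: `η^{[b]} · η^{[b']} = 0` for `b ≠ b'`.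
[cite: FoleyEtAl2005, §2.2 (`η^{(i)} ⊗ η^{(j)†} = 0` for all `i ≠ j`, read on the diagonal)] -/
theorem dotProduct_dilute_of_ne (c : n → κ) {b b' : κ} (h : b ≠ b') (z : n → ℝ) :
    dotProduct (dilute c b z) (dilute c b' z) = 0 :=
  Finset.sum_eq_zero fun i _ => dilute_mul_dilute_of_ne c h z i

omit [Fintype n] [DecidableEq n] in
/-- Summing the block indicator over the blocks: `Σ_b 𝟙[c i = b ∧ c j = b] t = 𝟙[c i = c j] t`
(private bookkeeping). [folklore] -/
private theorem sum_ite_and (c : n → κ) (i j : n) (t : ℝ) :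
    (∑ b, if c i = b ∧ c j = b then t else 0) = if c i = c j then t else 0 := by
  by_cases h : c i = c j
  · rw [if_pos h]
    have e : ∀ b, (c i = b ∧ c j = b) ↔ c i = b := fun b =>
      ⟨fun hb => hb.1, fun hb => ⟨hb, h ▸ hb⟩⟩
    simp_rw [e]
    simp
  · rw [if_neg h]
    refine Finset.sum_eq_zero fun b _ => ?_
    rw [if_neg]
    rintro ⟨h1, h2⟩
    exact h (h1.trans h2.symm)

/-! ## The block mask and the diluted trace estimator -/

/-- The BLOCK MASK of a matrix under the scheme `c`: `A_ij` is kept iff `i` and `j` lie in the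
same block — the pattern of the `E(η^{[b]}_i η^{[b]}_j)` that are not "exact zeros".
[cite: MorningstarEtAl2011, §III ("exact zeros for many of the `E(ηᵢηⱼ^*)` elements")] -/
def blockMask (c : n → κ) (A : Matrix n n ℝ) : Matrix n n ℝ :=
  Matrix.of fun i j => if c i = c j then A i j else 0

omit [Fintype n] [DecidableEq n] [Fintype κ] [DecidableEq κ] in
/-- Unfolding `blockMask`. [cite: MorningstarEtAl2011, §III] -/
@[simp] theorem blockMask_apply [DecidableEq κ] (c : n → κ) (A : Matrix n n ℝ) (i j : n) :
    blockMask c A i j = if c i = c j then A i j else 0 := rfl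

omit [DecidableEq n] [Fintype κ] in
/-- The block mask keeps the diagonal, hence the trace. [cite: MorningstarEtAl2011, §III
(the estimate stays an estimate of `Ω⁻¹`, i.e. unbiased)] -/
theorem trace_blockMask (c : n → κ) (A : Matrix n n ℝ) : (blockMask c A).trace = A.trace := by
  simp [Matrix.trace]

omit [Fintype n] [Fintype κ] in
/-- The off-diagonal part of the block mask is the masked off-diagonal part.
[cite: MorningstarEtAl2011, §III] -/
theorem offd_blockMask (c : n → κ) (A : Matrix n n ℝ) (i j : n) :
    offd (blockMask c A) i j = if c i = c j then offd A i j else 0 := by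
  unfold offd
  by_cases h : i = j
  · subst h; simp
  · simp [h]

/-- The DILUTED TRACE ESTIMATOR with one noise vector: `Σ_b (η^{[b]})ᵀ A η^{[b]}` — one
quadratic form (one solve when `A = Ω⁻¹`) per block. [cite: FoleyEtAl2005, §2.1 ("Each diluted
source is inverted, yielding `N_d` pairs of vectors")]; [cite: MorningstarEtAl2011, §III
(`Σ_b X^{r[b]}_i η^{r[b]*}_j`, traced)] -/
def dilutedTraceEst (c : n → κ) (A : Matrix n n ℝ) (z : n → ℝ) : ℝ :=
  ∑ b, traceEst A (dilute c b z)

omit [DecidableEq n] in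
/-- **The diluted trace estimator is the undiluted estimator of the block-masked matrix**:
`Σ_b (P^{(b)}z)ᵀ A (P^{(b)}z) = zᵀ (A ∘ 𝟙[c i = c j]) z`. [cite: MorningstarEtAl2011, §III
("The dilution projections ensure exact zeros for many of the `E(ηᵢηⱼ^*)` elements")] -/
theorem dilutedTraceEst_eq (c : n → κ) (A : Matrix n n ℝ) (z : n → ℝ) :
    dilutedTraceEst c A z = traceEst (blockMask c A) z := by
  unfold dilutedTraceEst traceEst
  rw [Finset.sum_comm]
  refine Finset.sum_congr rfl fun i _ => ?_
  rw [Finset.sum_comm]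
  refine Finset.sum_congr rfl fun j _ => ?_
  simp_rw [dilute_mul_dilute, mul_ite, mul_zero, sum_ite_and, blockMask_apply]
  split_ifs <;> simp

omit [DecidableEq n] [DecidableEq κ] in
/-- **No dilution** (one block) is the plain estimator `zᵀAz`. [cite: MorningstarEtAl2011, §III
("`P^{(b)}_{ij} = δ_{ij}`, `b = 0` (no dilution)")] -/
theorem dilutedTraceEst_const (A : Matrix n n ℝ) (z : n → ℝ) :
    dilutedTraceEst (fun _ : n => ()) A z = traceEst A z := by
  classical
  have e : blockMask (fun _ : n => ()) A = A := by
    ext i j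
    simp
  rw [dilutedTraceEst_eq, e]

/-- **Full dilution** (`c` injective: one block per index) leaves only the diagonal:
`Σ_b (η^{[b]})ᵀ A η^{[b]} = Σᵢ Aᵢᵢ zᵢ²`. [cite: MorningstarEtAl2011, §III
("`P^{(b)}_{ij} = δ_{ij} δ_{bi}` (full dilution)")]; [cite: FoleyEtAl2005, §2.1 (the
"homeopathic" limit)] -/
theorem dilutedTraceEst_of_injective {c : n → κ} (hc : Function.Injective c) (A : Matrix n n ℝ)
    (z : n → ℝ) : dilutedTraceEst c A z = ∑ i, A i i * z i ^ 2 := by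
  rw [dilutedTraceEst_eq]
  unfold traceEst
  refine Finset.sum_congr rfl fun i _ => ?_
  have hp : ∀ j, blockMask c A i j * (z i * z j) =
      if i = j then A i i * z i ^ 2 else 0 := by
    intro j
    rw [blockMask_apply]
    by_cases h : i = j
    · subst h
      rw [if_pos rfl, if_pos rfl]
      ring
    · rw [if_neg (fun e => h (hc e)), if_neg h, zero_mul]
  rw [Finset.sum_congr rfl fun j _ => hp j, Finset.sum_ite_eq]
  simp

/-- **Full dilution with unit-modulus noise is EXACT for every draw**: if `zᵢ² = 1` for all `i`
(`±1` noise; "each component of the noise vectors has modulus 1", eq. (mod1)) then the fully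
diluted estimate equals `tr A` identically — "results in the *exact* all-to-all propagator in a
finite number of steps, because of the property of Eq. (mod1)". [cite: FoleyEtAl2005, §2.1];
[cite: MorningstarEtAl2011, §III ("The use of `Z_N` noise ensures zero variance in our estimates
of the diagonal elements")] -/
theorem dilutedTraceEst_eq_trace_of_injective {c : n → κ} (hc : Function.Injective c)
    (A : Matrix n n ℝ) {z : n → ℝ} (hz : ∀ i, z i ^ 2 = 1) :
    dilutedTraceEst c A z = A.trace := by
  rw [dilutedTraceEst_of_injective hc]
  simp [hz, Matrix.trace]

section Moments

variable {μ : Measure ℝ} [IsProbabilityMeasure μ] (hμ : IsUnitNoise μ)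
include hμ

/-- **UNBIASEDNESS of the diluted trace estimator** (one noise vector, any scheme):
`E[Σ_b (η^{[b]})ᵀ A η^{[b]}] = tr A` — "an unbiased estimator … with a *single* noise source".
[cite: FoleyEtAl2005, §2.1]; [cite: MorningstarEtAl2011, §III] -/
theorem integral_dilutedTraceEst (c : n → κ) (A : Matrix n n ℝ) :
    ∫ z, dilutedTraceEst c A z ∂(Measure.pi fun _ : n => μ) = A.trace := by
  simp_rw [dilutedTraceEst_eq]
  rw [integral_traceEst hμ, trace_blockMask]

/-- **EXACT VARIANCE of the diluted trace estimator**: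
`E[(Σ_b (η^{[b]})ᵀAη^{[b]} − tr A)²] = (m₄ − 1) Σᵢ A²ᵢᵢ + Σ_{i ≠ j, c i = c j} Aᵢⱼ(Aᵢⱼ + Aⱼᵢ)` —
the undiluted variance [DongLiu1994, eq. (5)] with every CROSS-BLOCK pair struck out ("exact zeros
for many of the `E(ηᵢηⱼ^*)` elements instead of estimates that are only statistically zero,
resulting in a … reduction in the variance"). [cite: MorningstarEtAl2011, §III];
[cite: DongLiu1994, eq. (5)] -/
theorem variance_dilutedTraceEst (c : n → κ) (A : Matrix n n ℝ) :
    ∫ z, (dilutedTraceEst c A z - A.trace) ^ 2 ∂(Measure.pi fun _ : n => μ) =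
      (∫ x, x ^ 4 ∂μ - 1) * ∑ i, A i i ^ 2 +
        ∑ i, ∑ j, if c i = c j then offd A i j * (A i j + A j i) else 0 := by
  simp_rw [dilutedTraceEst_eq]
  rw [← trace_blockMask c A, variance_traceEst hμ]
  congr 1
  · simp
  · refine Finset.sum_congr rfl fun i _ => Finset.sum_congr rfl fun j _ => ?_
    rw [offd_blockMask, blockMask_apply, blockMask_apply]
    by_cases h : c i = c j
    · rw [if_pos h, if_pos h, if_pos h.symm, if_pos h]
    · rw [if_neg h, if_neg h, if_neg h, zero_mul]

end Moments

/-! ## Refining the scheme never increases the variance -/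

omit [Fintype n] in
/-- For `i ≠ j` the off-diagonal term `offd A i j (A i j + A j i)` only sees off-diagonal entries
(private rewriting). [folklore] -/
private theorem offd_mul_add (A : Matrix n n ℝ) (i j : n) :
    offd A i j * (A i j + A j i) = offd A i j * (offd A i j + offd A j i) := by
  unfold offd
  by_cases h : i = j
  · subst h; simp
  · rw [if_neg h, if_neg (Ne.symm h)]

/-- **Symmetrisation**: for a symmetric weight `w`,
`2 Σᵢⱼ wᵢⱼ · offd A i j (Aᵢⱼ + Aⱼᵢ) = Σᵢⱼ wᵢⱼ (offd A i j + offd A j i)²` — each unordered pair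
`{i, j}` contributes `wᵢⱼ (Aᵢⱼ + Aⱼᵢ)²` to the off-diagonal variance (private). [folklore] -/
private theorem two_mul_sum_weight (w : n → n → ℝ) (hw : ∀ i j, w i j = w j i) (A : Matrix n n ℝ) :
    2 * ∑ i, ∑ j, w i j * (offd A i j * (A i j + A j i)) =
      ∑ i, ∑ j, w i j * (offd A i j + offd A j i) ^ 2 := by
  set S := ∑ i, ∑ j, w i j * (offd A i j * (A i j + A j i)) with hS
  have h1 : S = ∑ i, ∑ j, w i j * (offd A i j * (offd A i j + offd A j i)) :=
    Finset.sum_congr rfl fun i _ => Finset.sum_congr rfl fun j _ => by rw [offd_mul_add]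
  have h2 : S = ∑ i, ∑ j, w i j * (offd A j i * (offd A i j + offd A j i)) := by
    rw [h1, Finset.sum_comm]
    refine Finset.sum_congr rfl fun i _ => Finset.sum_congr rfl fun j _ => ?_
    rw [hw j i]
    ring
  calc 2 * S = S + S := two_mul S
    _ = ∑ i, ∑ j, w i j * (offd A i j * (offd A i j + offd A j i)) +
          ∑ i, ∑ j, w i j * (offd A j i * (offd A i j + offd A j i)) := by rw [← h1, ← h2]
    _ = ∑ i, ∑ j, w i j * (offd A i j + offd A j i) ^ 2 := by
        rw [← Finset.sum_add_distrib]
        refine Finset.sum_congr rfl fun i _ => ?_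
        rw [← Finset.sum_add_distrib]
        exact Finset.sum_congr rfl fun j _ => by ring

/-- A symmetric non-negative weight gives a non-negative off-diagonal contribution (private).
[folklore] -/
private theorem sum_weight_nonneg (w : n → n → ℝ) (hw : ∀ i j, w i j = w j i)
    (hw0 : ∀ i j, 0 ≤ w i j) (A : Matrix n n ℝ) :
    0 ≤ ∑ i, ∑ j, w i j * (offd A i j * (A i j + A j i)) := by
  have h := two_mul_sum_weight w hw A
  have h0 : 0 ≤ ∑ i, ∑ j, w i j * (offd A i j + offd A j i) ^ 2 :=
    Finset.sum_nonneg fun i _ => Finset.sum_nonneg fun j _ =>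
      mul_nonneg (hw0 i j) (sq_nonneg _)
  linarith

omit [Fintype κ] in
/-- **MONOTONICITY under refinement** (off-diagonal term): if the scheme `c'` refines `c` (every
block of `c'` lies inside a block of `c`) then
`Σ_{c' i = c' j} offd A i j (Aᵢⱼ + Aⱼᵢ) ≤ Σ_{c i = c j} offd A i j (Aᵢⱼ + Aⱼᵢ)` — more projectors,
more exact zeros ("The effectiveness of the variance reduction depends on the projectors chosen").
[cite: MorningstarEtAl2011, §III] -/
theorem sum_blockTerm_mono {κ' : Type*} [DecidableEq κ'] {c : n → κ} {c' : n → κ'}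
    (h : ∀ i j, c' i = c' j → c i = c j) (A : Matrix n n ℝ) :
    (∑ i, ∑ j, if c' i = c' j then offd A i j * (A i j + A j i) else 0) ≤
      ∑ i, ∑ j, if c i = c j then offd A i j * (A i j + A j i) else 0 := by
  -- the difference is the weighted sum with `w = 𝟙[c i = c j] − 𝟙[c' i = c' j] ∈ {0, 1}`
  set w : n → n → ℝ := fun i j => if c i = c j ∧ ¬ c' i = c' j then 1 else 0 with hw
  have hsymm : ∀ i j, w i j = w j i := by
    intro i j
    simp only [hw]
    by_cases h1 : c i = c j <;> by_cases h2 : c' i = c' j <;>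
      simp [h1, h2, eq_comm]
  have hpos : ∀ i j, 0 ≤ w i j := fun i j => by simp only [hw]; split_ifs <;> norm_num
  have hdiff : (∑ i, ∑ j, if c i = c j then offd A i j * (A i j + A j i) else 0) -
      (∑ i, ∑ j, if c' i = c' j then offd A i j * (A i j + A j i) else 0) =
      ∑ i, ∑ j, w i j * (offd A i j * (A i j + A j i)) := by
    rw [← Finset.sum_sub_distrib]
    refine Finset.sum_congr rfl fun i _ => ?_
    rw [← Finset.sum_sub_distrib]
    refine Finset.sum_congr rfl fun j _ => ?_
    simp only [hw]
    by_cases h2 : c' i = c' j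
    · rw [if_pos (h i j h2), if_pos h2, if_neg (fun hh => hh.2 h2)]
      ring
    · by_cases h1 : c i = c j
      · rw [if_pos h1, if_neg h2, if_pos ⟨h1, h2⟩]
        ring
      · rw [if_neg h1, if_neg h2, if_neg (fun hh => h1 hh.1)]
        ring
  have := sum_weight_nonneg w hsymm hpos A
  linarith

section MomentsMono

variable {μ : Measure ℝ} [IsProbabilityMeasure μ] (hμ : IsUnitNoise μ)
include hμ

/-- **Refining a dilution scheme never increases the variance of the trace estimator**: if every
block of `c'` lies inside a block of `c` then `Var(c') ≤ Var(c)`.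
[cite: MorningstarEtAl2011, §III ("The effectiveness of the variance reduction depends on the
projectors chosen")]; [cite: FoleyEtAl2005, §2.2] -/
theorem variance_dilutedTraceEst_mono {κ' : Type*} [Fintype κ'] [DecidableEq κ'] {c : n → κ}
    {c' : n → κ'} (h : ∀ i j, c' i = c' j → c i = c j) (A : Matrix n n ℝ) :
    ∫ z, (dilutedTraceEst c' A z - A.trace) ^ 2 ∂(Measure.pi fun _ : n => μ) ≤
      ∫ z, (dilutedTraceEst c A z - A.trace) ^ 2 ∂(Measure.pi fun _ : n => μ) := by
  rw [variance_dilutedTraceEst hμ, variance_dilutedTraceEst hμ]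
  have := sum_blockTerm_mono h A
  linarith

/-- **Dilution never increases the variance**: for EVERY scheme `c`, the diluted trace estimator
with one noise vector has variance at most that of the undiluted single-probe estimator `zᵀAz`
("This results in smaller variance than the standard method which mixes noise").
[cite: FoleyEtAl2005, §2.2]; [cite: MorningstarEtAl2011, §III] -/
theorem variance_dilutedTraceEst_le (c : n → κ) (A : Matrix n n ℝ) :
    ∫ z, (dilutedTraceEst c A z - A.trace) ^ 2 ∂(Measure.pi fun _ : n => μ) ≤
      ∫ z, (traceEst A z - A.trace) ^ 2 ∂(Measure.pi fun _ : n => μ) := by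
  have h := variance_dilutedTraceEst_mono hμ (c := fun _ : n => ()) (c' := c)
    (fun _ _ _ => rfl) A
  simpa only [dilutedTraceEst_const] using h

/-- **Full dilution: only the diagonal error survives**: for an injective scheme
`Var = (m₄ − 1) Σᵢ A²ᵢᵢ`. [cite: MorningstarEtAl2011, §III (full dilution; "zero variance in …
the diagonal elements" for `Z_N` noise)] -/
theorem variance_dilutedTraceEst_of_injective {c : n → κ} (hc : Function.Injective c)
    (A : Matrix n n ℝ) :
    ∫ z, (dilutedTraceEst c A z - A.trace) ^ 2 ∂(Measure.pi fun _ : n => μ) =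
      (∫ x, x ^ 4 ∂μ - 1) * ∑ i, A i i ^ 2 := by
  rw [variance_dilutedTraceEst hμ]
  have h0 : (∑ i, ∑ j, if c i = c j then offd A i j * (A i j + A j i) else 0) = 0 := by
    refine Finset.sum_eq_zero fun i _ => Finset.sum_eq_zero fun j _ => ?_
    by_cases h : i = j
    · subst h; simp
    · rw [if_neg (fun e => h (hc e))]
  rw [h0, add_zero]

end MomentsMono

/-- **Full dilution with `±1` noise has ZERO variance** (`m₄ = 1`): the homeopathic limit is exact.
[cite: FoleyEtAl2005, §2.1 ("results in the *exact* all-to-all propagator in a finite number of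
steps")]; [cite: MorningstarEtAl2011, §III] -/
theorem variance_dilutedTraceEst_of_injective_rademacher {c : n → κ} (hc : Function.Injective c)
    (A : Matrix n n ℝ) :
    ∫ z, (dilutedTraceEst c A z - A.trace) ^ 2 ∂(Measure.pi fun _ : n => rademacherLaw) = 0 := by
  rw [variance_dilutedTraceEst_of_injective isUnitNoise_rademacherLaw hc, fourthMoment_rademacherLaw]
  ring

/-! ## The diluted matrix-element (propagator) estimator -/

/-- The DILUTED MATRIX-ELEMENT ESTIMATOR of `Bᵢⱼ` with one noise vector:
`Σ_b X^{[b]}_i η^{[b]}_j`, `X^{[b]} = B η^{[b]}` (`B = Ω⁻¹`; "`Σ_i ψ^{(i)} ⊗ η^{(i)†}`").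
[cite: FoleyEtAl2005, §2.1]; [cite: MorningstarEtAl2011, §III (`Σ_b X^{r[b]}_i η^{r[b]*}_j`)] -/
def dilutedElemEst (c : n → κ) (B : Matrix n n ℝ) (i j : n) (z : n → ℝ) : ℝ :=
  ∑ b, elemEst B i j (dilute c b z)

/-- The COLUMN-BLOCK mask at `j`: `B_ik` is kept iff `k` lies in the block of `j`.
[cite: MorningstarEtAl2011, §III ("exact zeros for many of the `E(ηᵢηⱼ^*)` elements")] -/
def colBlock (c : n → κ) (j : n) (B : Matrix n n ℝ) : Matrix n n ℝ :=
  Matrix.of fun i k => if c k = c j then B i k else 0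

omit [Fintype n] [DecidableEq n] [Fintype κ] [DecidableEq κ] in
/-- Unfolding `colBlock`. [cite: MorningstarEtAl2011, §III] -/
@[simp] theorem colBlock_apply [DecidableEq κ] (c : n → κ) (j : n) (B : Matrix n n ℝ) (i k : n) :
    colBlock c j B i k = if c k = c j then B i k else 0 := rfl

omit [DecidableEq n] in
/-- **The diluted element estimator is the undiluted estimator of the column-masked matrix**:
`Σ_b X^{[b]}_i η^{[b]}_j = (Σ_{k : c k = c j} B_ik η_k) ηⱼ`. [cite: MorningstarEtAl2011, §III] -/
theorem dilutedElemEst_eq (c : n → κ) (B : Matrix n n ℝ) (i j : n) (z : n → ℝ) :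
    dilutedElemEst c B i j z = elemEst (colBlock c j B) i j z := by
  unfold dilutedElemEst elemEst
  simp_rw [Finset.sum_mul]
  rw [Finset.sum_comm]
  refine Finset.sum_congr rfl fun k _ => ?_
  simp_rw [mul_assoc, dilute_mul_dilute, mul_ite, mul_zero, sum_ite_and, colBlock_apply]
  split_ifs <;> simp

section ElemMoments

variable {μ : Measure ℝ} [IsProbabilityMeasure μ] (hμ : IsUnitNoise μ)
include hμ

/-- **UNBIASEDNESS of the diluted element estimator**: `E[Σ_b X^{[b]}_i η^{[b]}_j] = Bᵢⱼ` — "an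
unbiased estimator of `M⁻¹` with a *single* noise source". [cite: FoleyEtAl2005, §2.1];
[cite: MorningstarEtAl2011, §III ("a much better Monte Carlo estimate of `Ω⁻¹ᵢⱼ`")] -/
theorem integral_dilutedElemEst (c : n → κ) (B : Matrix n n ℝ) (i j : n) :
    ∫ z, dilutedElemEst c B i j z ∂(Measure.pi fun _ : n => μ) = B i j := by
  simp_rw [dilutedElemEst_eq]
  rw [integral_elemEst hμ]
  simp

/-- **EXACT VARIANCE of the diluted element estimator**:
`Var[Σ_b X^{[b]}_i η^{[b]}_j] = (m₄ − 1) B²ᵢⱼ + Σ_{k ≠ j, c k = c j} B²ᵢₖ` — Dong–Liu's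
`C₂²[M⁻¹ᵢⱼ]² + Σ_{k≠j}[M⁻¹ᵢₖ]²` with the sum restricted to the block of `j`.
[cite: MorningstarEtAl2011, §III ("resulting in a dramatic reduction in the variance of the `Ω⁻¹`
estimates")]; [cite: DongLiu1994, eq. (5)] -/
theorem variance_dilutedElemEst (c : n → κ) (B : Matrix n n ℝ) (i j : n) :
    ∫ z, (dilutedElemEst c B i j z - B i j) ^ 2 ∂(Measure.pi fun _ : n => μ) =
      (∫ x, x ^ 4 ∂μ - 1) * B i j ^ 2 +
        ((∑ k, if c k = c j then B i k ^ 2 else 0) - B i j ^ 2) := by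
  simp_rw [dilutedElemEst_eq]
  have hjj : colBlock c j B i j = B i j := by simp
  rw [← hjj, variance_elemEst hμ, hjj]
  congr 2
  refine Finset.sum_congr rfl fun k _ => ?_
  rw [colBlock_apply]
  split_ifs <;> simp

/-- **Refining the scheme never increases the variance of the element estimator** (termwise:
fewer `k` share the block of `j`). [cite: MorningstarEtAl2011, §III ("The effectiveness of the
variance reduction depends on the projectors chosen")] -/
theorem variance_dilutedElemEst_mono {κ' : Type*} [Fintype κ'] [DecidableEq κ'] {c : n → κ}
    {c' : n → κ'} (h : ∀ k l, c' k = c' l → c k = c l) (B : Matrix n n ℝ) (i j : n) :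
    ∫ z, (dilutedElemEst c' B i j z - B i j) ^ 2 ∂(Measure.pi fun _ : n => μ) ≤
      ∫ z, (dilutedElemEst c B i j z - B i j) ^ 2 ∂(Measure.pi fun _ : n => μ) := by
  rw [variance_dilutedElemEst hμ, variance_dilutedElemEst hμ]
  have hk : ∀ k, (if c' k = c' j then B i k ^ 2 else 0) ≤ if c k = c j then B i k ^ 2 else 0 := by
    intro k
    by_cases h2 : c' k = c' j
    · rw [if_pos h2, if_pos (h k j h2)]
    · rw [if_neg h2]
      split_ifs <;> nlinarith [sq_nonneg (B i k)]
  have := Finset.sum_le_sum fun k (_ : k ∈ Finset.univ) => hk k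
  linarith

/-- **Dilution never increases the variance of the element estimator**: every scheme beats (or
ties) the undiluted single-probe estimate `Xᵢηⱼ`. [cite: FoleyEtAl2005, §2.2 ("smaller variance
than the standard method which mixes noise")]; [cite: MorningstarEtAl2011, §III] -/
theorem variance_dilutedElemEst_le (c : n → κ) (B : Matrix n n ℝ) (i j : n) :
    ∫ z, (dilutedElemEst c B i j z - B i j) ^ 2 ∂(Measure.pi fun _ : n => μ) ≤
      ∫ z, (elemEst B i j z - B i j) ^ 2 ∂(Measure.pi fun _ : n => μ) := by
  rw [variance_dilutedElemEst hμ, variance_elemEst hμ]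
  have hk : ∀ k, (if c k = c j then B i k ^ 2 else 0) ≤ B i k ^ 2 := fun k => by
    split_ifs <;> nlinarith [sq_nonneg (B i k)]
  have := Finset.sum_le_sum fun k (_ : k ∈ Finset.univ) => hk k
  linarith

/-- **Full dilution: only the diagonal error survives** — `Var = (m₄ − 1) B²ᵢⱼ` for an injective
scheme. [cite: MorningstarEtAl2011, §III (full dilution)] -/
theorem variance_dilutedElemEst_of_injective {c : n → κ} (hc : Function.Injective c)
    (B : Matrix n n ℝ) (i j : n) :
    ∫ z, (dilutedElemEst c B i j z - B i j) ^ 2 ∂(Measure.pi fun _ : n => μ) =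
      (∫ x, x ^ 4 ∂μ - 1) * B i j ^ 2 := by
  rw [variance_dilutedElemEst hμ]
  have hs : (∑ k, if c k = c j then B i k ^ 2 else 0) = B i j ^ 2 := by
    have hp : ∀ k, (if c k = c j then B i k ^ 2 else 0) = if k = j then B i k ^ 2 else 0 := by
      intro k
      by_cases hk : k = j
      · subst hk; simp
      · rw [if_neg (fun e => hk (hc e)), if_neg hk]
    rw [Finset.sum_congr rfl fun k _ => hp k, Finset.sum_ite_eq']
    simp
  rw [hs]
  ring

end ElemMoments

/-- **Full dilution with `±1` noise: the element estimate has ZERO variance.**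
[cite: FoleyEtAl2005, §2.1 (exact in the homeopathic limit)]; [cite: MorningstarEtAl2011, §III] -/
theorem variance_dilutedElemEst_of_injective_rademacher {c : n → κ} (hc : Function.Injective c)
    (B : Matrix n n ℝ) (i j : n) :
    ∫ z, (dilutedElemEst c B i j z - B i j) ^ 2 ∂(Measure.pi fun _ : n => rademacherLaw) = 0 := by
  rw [variance_dilutedElemEst_of_injective isUnitNoise_rademacherLaw hc, fourthMoment_rademacherLaw]
  ring

/-- **Full dilution is exact draw by draw**: for an injective scheme and a noise draw with
`zⱼ² = 1`, `Σ_b X^{[b]}_i η^{[b]}_j = Bᵢⱼ` identically ("the *exact* all-to-all propagator in a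
finite number of steps, because of the property of Eq. (mod1)"). [cite: FoleyEtAl2005, §2.1] -/
theorem dilutedElemEst_eq_of_injective {c : n → κ} (hc : Function.Injective c) (B : Matrix n n ℝ)
    (i j : n) {z : n → ℝ} (hz : z j ^ 2 = 1) : dilutedElemEst c B i j z = B i j := by
  rw [dilutedElemEst_eq]
  unfold elemEst
  have hp : ∀ k, colBlock c j B i k * z k = if k = j then B i j * z j else 0 := by
    intro k
    rw [colBlock_apply]
    by_cases hk : k = j
    · subst hk; simp
    · rw [if_neg (fun e => hk (hc e)), if_neg hk, zero_mul]
  rw [Finset.sum_congr rfl fun k _ => hp k, Finset.sum_ite_eq']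
  simp only [Finset.mem_univ, if_true]
  rw [mul_assoc, ← sq, hz, mul_one]

/-! ## The price: one solve per block -/

omit [DecidableEq n] [Fintype κ] in
/-- **The number of solves per noise vector** — the number of non-empty blocks `|c(n)|` — is at
most the number of indices. [cite: FoleyEtAl2005, §2.1 ("Each diluted source is inverted, yielding
`N_d` pairs of vectors"; "a finite number of steps")] -/
theorem card_blocks_le (c : n → κ) : (Finset.univ.image c).card ≤ Fintype.card n :=
  Finset.card_image_le

omit [DecidableEq n] [Fintype κ] in
/-- **Exactness costs `card n` solves**: the number of blocks equals the number of indices iff the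
scheme is full dilution (`c` injective) — "This limit cannot be reached in practice on realistic
lattices". [cite: FoleyEtAl2005, §2.1] -/
theorem card_blocks_eq_iff (c : n → κ) :
    (Finset.univ.image c).card = Fintype.card n ↔ Function.Injective c := by
  rw [← Finset.card_univ, Finset.card_image_iff]
  simp [Set.InjOn, Function.Injective]

end Dilution

end StochasticTrace

end Literature.Probability.Moments
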